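import Summits.QuantumFields.YangMills.Theorems.AllWindowsColdBoxBoxHighLineTiltCum5BoundGauss
import Summits.QuantumFields.YangMills.Theorems.AllWindowsColdBoxBoxHighLineTiltCum4Bound

/-!
# U5-L3c′: the fifth tilted cumulant of the plaquette costs along the UNtruncated tilt `tiltU β H` over `μ_D`

Continuation of ✓`…TiltCum5BoundGauss` (`Tilt.abs_tiltCum5_muD_le`, globally bounded `U`) in the pattern of w5 g23's ✓`…TiltCum4Bound` (K4):
`tiltU β H` is bounded only ON `D = smallField H s`, so one tilts by the truncation `Ũ = 1_D·tiltU` (bounded everywhere) and transports the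
cumulant back by a.e.-congruence on `μ_D` (✓13u `Tilt.indicator_ae_eq_of_ae_mem`, ✓`Tilt.ae_muD_mem_smallField`):

* `Tilt.tiltCum5_congr_ae` — `κ₅,t` depends only on the `μ`-a.e. classes of `U, G₁, G₂` (companion of ✓`tiltCum3/4_congr_ae`);
* ★★ **`GaussNormalForm.abs_tiltCum5_muD_tiltU_le`** — for `sup_D |tiltU| ≤ B`, `E₀[1_D] > 0`, `0 ≤ t`, all sites `x y` and constants `a₁ a₂ b`:
  `|κ₅,t(c_x, c_y; tiltU, tiltU, tiltU)|` over `μ_D` is at most the bound of ✓`Tilt.abs_tiltCum5_le_of_moments` at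
  `mᵢ := E·R((c−aᵢ)²)`, `qᵢ := E·R((c−aᵢ)⁴)`, `u_k := E·R((tiltU−b)^k)` (`k = 2,4,6`), `E = e^{2tB}`, `R(Y) = E₀[1_D·Y]/E₀[1_D]` — every slot a
  restricted GAUSSIAN moment of the UNtruncated observables (the indicator is removed inside `1_D·(…)` by ✓`sfInd_mul_indicator_eq`).

This is the `hK`-input shape of ✓`tiltThirdOrder` for U5's Step (e5′) («f‴ = κ₅,t by Cauchy–Schwarz + norm transfer»); the SIZES of the seven slots
(✓13K-M for the plaquette slots; V₃-hypercontractivity + even-part fluctuations for the `U`-slots) are the next file (L3-concrete).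
Tree + Mathlib; no definitions; standard axioms.  HONEST LABEL: U5 prep, helper; U5 ⟨stmt-QuantumFields-24336⟩, ⟨24004⟩ OPEN; route AllWindowsColdBox DRAFT;
the Yang–Mills mass gap is NOT proved by this file; no summit is proved by a line.  Seat ym-line-fcl-p3 g26.
-/

set_option autoImplicit false

noncomputable section

open MeasureTheory Set Real
open Literature.Probability.LatticeModels (Site)
open Summit.QuantumFields.YangMills.Cruxes.NT.SkewResponse

namespace Summit.QuantumFields.YangMills.Theorems.AllWindowsColdBoxBoxHighLine

/-! ## §1 A.e.-congruence of the fifth cumulant -/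

namespace Tilt

section CongrAE

variable {Ω : Type*} [MeasurableSpace Ω] {μ : Measure Ω} {U U' : Ω → ℝ}

/-- `tiltCum5` only depends on the `μ`-a.e. classes of `U`, `G₁`, `G₂`. -/
theorem tiltCum5_congr_ae (hU : U =ᵐ[μ] U') {G₁ G₁' G₂ G₂' : Ω → ℝ} (h₁ : G₁ =ᵐ[μ] G₁') (h₂ : G₂ =ᵐ[μ] G₂') (t : ℝ) :
    tiltCum5 μ U t G₁ G₂ = tiltCum5 μ U' t G₁' G₂' := by
  unfold tiltCum5
  rw [tiltExp_congr_ae hU h₁ t, tiltExp_congr_ae hU h₂ t, tiltExp_congr_ae hU hU t]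
  have hA : (fun x => (G₁ x - tiltExp μ U' t G₁') * (G₂ x - tiltExp μ U' t G₂') * (U x - tiltExp μ U' t U') ^ 3) =ᵐ[μ]
      fun x => (G₁' x - tiltExp μ U' t G₁') * (G₂' x - tiltExp μ U' t G₂') * (U' x - tiltExp μ U' t U') ^ 3 := by
    filter_upwards [hU, h₁, h₂] with x hx h1x h2x
    rw [hx, h1x, h2x]
  have hB : (fun x => (G₁ x - tiltExp μ U' t G₁') * (G₂ x - tiltExp μ U' t G₂')) =ᵐ[μ]
      fun x => (G₁' x - tiltExp μ U' t G₁') * (G₂' x - tiltExp μ U' t G₂') := by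
    filter_upwards [h₁, h₂] with x h1x h2x
    rw [h1x, h2x]
  have hC : (fun x => (U x - tiltExp μ U' t U') ^ 3) =ᵐ[μ] fun x => (U' x - tiltExp μ U' t U') ^ 3 := by
    filter_upwards [hU] with x hx
    rw [hx]
  have hC2 : (fun x => (U x - tiltExp μ U' t U') ^ 2) =ᵐ[μ] fun x => (U' x - tiltExp μ U' t U') ^ 2 := by
    filter_upwards [hU] with x hx
    rw [hx]
  have hD₁ : (fun x => (G₁ x - tiltExp μ U' t G₁') * (U x - tiltExp μ U' t U')) =ᵐ[μ]
      fun x => (G₁' x - tiltExp μ U' t G₁') * (U' x - tiltExp μ U' t U') := by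
    filter_upwards [hU, h₁] with x hx h1x
    rw [hx, h1x]
  have hD₂ : (fun x => (G₂ x - tiltExp μ U' t G₂') * (U x - tiltExp μ U' t U')) =ᵐ[μ]
      fun x => (G₂' x - tiltExp μ U' t G₂') * (U' x - tiltExp μ U' t U') := by
    filter_upwards [hU, h₂] with x hx h2x
    rw [hx, h2x]
  have hE₁ : (fun x => (G₁ x - tiltExp μ U' t G₁') * (U x - tiltExp μ U' t U') ^ 2) =ᵐ[μ]
      fun x => (G₁' x - tiltExp μ U' t G₁') * (U' x - tiltExp μ U' t U') ^ 2 := by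
    filter_upwards [hU, h₁] with x hx h1x
    rw [hx, h1x]
  have hE₂ : (fun x => (G₂ x - tiltExp μ U' t G₂') * (U x - tiltExp μ U' t U') ^ 2) =ᵐ[μ]
      fun x => (G₂' x - tiltExp μ U' t G₂') * (U' x - tiltExp μ U' t U') ^ 2 := by
    filter_upwards [hU, h₂] with x hx h2x
    rw [hx, h2x]
  have hF : (fun x => (G₁ x - tiltExp μ U' t G₁') * (G₂ x - tiltExp μ U' t G₂') * (U x - tiltExp μ U' t U')) =ᵐ[μ]
      fun x => (G₁' x - tiltExp μ U' t G₁') * (G₂' x - tiltExp μ U' t G₂') * (U' x - tiltExp μ U' t U') := by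
    filter_upwards [hU, h₁, h₂] with x hx h1x h2x
    rw [hx, h1x, h2x]
  rw [tiltExp_congr_ae hU hA t, tiltExp_congr_ae hU hB t, tiltExp_congr_ae hU hC t, tiltExp_congr_ae hU hC2 t,
    tiltExp_congr_ae hU hD₁ t, tiltExp_congr_ae hU hD₂ t, tiltExp_congr_ae hU hE₁ t, tiltExp_congr_ae hU hE₂ t, tiltExp_congr_ae hU hF t]

end CongrAE

end Tilt

/-! ## §2 The fifth cumulant along the untruncated `tiltU` over `μ_D` -/

namespace GaussNormalForm

variable {H : ℕ}

/-- ★★ **`κ₅,t(c_x, c_y; tiltU)` over `μ_D` through restricted Gaussian moments of the UNtruncated observables**: for `sup_D |tiltU β H| ≤ B`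
(`0 ≤ B`), `∫ 1_D·gaussWeight > 0`, `0 ≤ t` and all constants `a₁ a₂ b`. -/
theorem abs_tiltCum5_muD_tiltU_le {β : ℝ} (hβ : 0 < β) {s : ℝ} (hD : 0 < ∫ a, sfInd H s a * gaussWeight β H a)
    {B : ℝ} (hB : 0 ≤ B) (hUD : ∀ a ∈ smallField H s, |tiltU β H a| ≤ B) {t : ℝ} (ht : 0 ≤ t) (x y : Site 4) (a₁ a₂ b : ℝ) :
    |Tilt.tiltCum5 ((volume.restrict (smallField H s)).withDensity fun a => ENNReal.ofReal (gaussWeight β H a))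
        (tiltU β H) t (chartPlaqCost H x 1 2) (chartPlaqCost H y 1 2)| ≤
      Real.sqrt (Real.sqrt (16 * (Real.exp (2 * t * B) *
              (gaussAvg β H (fun a => sfInd H s a * (chartPlaqCost H x 1 2 a - a₁) ^ 4) / gaussAvg β H (sfInd H s)))) *
            Real.sqrt (16 * (Real.exp (2 * t * B) *
              (gaussAvg β H (fun a => sfInd H s a * (chartPlaqCost H y 1 2 a - a₂) ^ 4) / gaussAvg β H (sfInd H s))))) *
          Real.sqrt (64 * (Real.exp (2 * t * B) *
            (gaussAvg β H (fun a => sfInd H s a * (tiltU β H a - b) ^ 6) / gaussAvg β H (sfInd H s)))) +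
        Real.sqrt (Real.exp (2 * t * B) * (gaussAvg β H (fun a => sfInd H s a * (chartPlaqCost H x 1 2 a - a₁) ^ 2) / gaussAvg β H (sfInd H s))) *
            Real.sqrt (Real.exp (2 * t * B) * (gaussAvg β H (fun a => sfInd H s a * (chartPlaqCost H y 1 2 a - a₂) ^ 2) / gaussAvg β H (sfInd H s))) *
          (Real.sqrt (Real.exp (2 * t * B) * (gaussAvg β H (fun a => sfInd H s a * (tiltU β H a - b) ^ 2) / gaussAvg β H (sfInd H s))) *
            Real.sqrt (16 * (Real.exp (2 * t * B) *
              (gaussAvg β H (fun a => sfInd H s a * (tiltU β H a - b) ^ 4) / gaussAvg β H (sfInd H s))))) +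
        3 * (Real.sqrt (Real.exp (2 * t * B) * (gaussAvg β H (fun a => sfInd H s a * (chartPlaqCost H x 1 2 a - a₁) ^ 2) / gaussAvg β H (sfInd H s))) *
              Real.sqrt (Real.exp (2 * t * B) * (gaussAvg β H (fun a => sfInd H s a * (tiltU β H a - b) ^ 2) / gaussAvg β H (sfInd H s))) *
            (Real.sqrt (Real.exp (2 * t * B) * (gaussAvg β H (fun a => sfInd H s a * (chartPlaqCost H y 1 2 a - a₂) ^ 2) / gaussAvg β H (sfInd H s))) *
              Real.sqrt (16 * (Real.exp (2 * t * B) *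
                (gaussAvg β H (fun a => sfInd H s a * (tiltU β H a - b) ^ 4) / gaussAvg β H (sfInd H s)))))) +
        3 * (Real.sqrt (Real.exp (2 * t * B) * (gaussAvg β H (fun a => sfInd H s a * (chartPlaqCost H y 1 2 a - a₂) ^ 2) / gaussAvg β H (sfInd H s))) *
              Real.sqrt (Real.exp (2 * t * B) * (gaussAvg β H (fun a => sfInd H s a * (tiltU β H a - b) ^ 2) / gaussAvg β H (sfInd H s))) *
            (Real.sqrt (Real.exp (2 * t * B) * (gaussAvg β H (fun a => sfInd H s a * (chartPlaqCost H x 1 2 a - a₁) ^ 2) / gaussAvg β H (sfInd H s))) *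
              Real.sqrt (16 * (Real.exp (2 * t * B) *
                (gaussAvg β H (fun a => sfInd H s a * (tiltU β H a - b) ^ 4) / gaussAvg β H (sfInd H s)))))) +
        3 * (Real.exp (2 * t * B) * (gaussAvg β H (fun a => sfInd H s a * (tiltU β H a - b) ^ 2) / gaussAvg β H (sfInd H s)) *
            (Real.sqrt (Real.sqrt (16 * (Real.exp (2 * t * B) *
                    (gaussAvg β H (fun a => sfInd H s a * (chartPlaqCost H x 1 2 a - a₁) ^ 4) / gaussAvg β H (sfInd H s)))) *
                  Real.sqrt (16 * (Real.exp (2 * t * B) *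
                    (gaussAvg β H (fun a => sfInd H s a * (chartPlaqCost H y 1 2 a - a₂) ^ 4) / gaussAvg β H (sfInd H s))))) *
              Real.sqrt (Real.exp (2 * t * B) *
                (gaussAvg β H (fun a => sfInd H s a * (tiltU β H a - b) ^ 2) / gaussAvg β H (sfInd H s))))) := by
  haveI := Tilt.isFiniteMeasure_muD H hβ s
  haveI := Tilt.neZero_muD H hβ hD
  -- the truncation `Ũ = 1_D·tiltU`, bounded by `B` everywhere, and the plaquette costs (bounded by 4)
  have hmU : Measurable ((smallField H s).indicator (tiltU β H)) := (measurable_tiltU β H).indicator (ChartGauss.measurableSet_smallField s)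
  have hUb : ∀ a, |(smallField H s).indicator (tiltU β H) a| ≤ B := fun a => Tilt.abs_indicator_le hB hUD a
  have hUD' : ∀ a ∈ smallField H s, |(smallField H s).indicator (tiltU β H) a| ≤ B := fun a _ => hUb a
  have hm₁ : Measurable (chartPlaqCost H x 1 2) := EdgeChartGaussian.measurable_chartPlaqCost H x 1 2
  have hm₂ : Measurable (chartPlaqCost H y 1 2) := EdgeChartGaussian.measurable_chartPlaqCost H y 1 2
  have h₁b : ∀ a, |chartPlaqCost H x 1 2 a| ≤ 4 := fun a => TiltSup.abs_chartPlaqCost_le_four (H := H) x 1 2 a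
  have h₂b : ∀ a, |chartPlaqCost H y 1 2 a| ≤ 4 := fun a => TiltSup.abs_chartPlaqCost_le_four (H := H) y 1 2 a
  -- a.e. on `μ_D` the truncation is the tilt exponent itself
  have hae := Tilt.indicator_ae_eq_of_ae_mem (Tilt.ae_muD_mem_smallField (H := H) β s) (tiltU β H)
  rw [← Tilt.tiltCum5_congr_ae hae (Filter.EventuallyEq.refl _ (chartPlaqCost H x 1 2)) (Filter.EventuallyEq.refl _ (chartPlaqCost H y 1 2)) t]
  have h := Tilt.abs_tiltCum5_muD_le H hβ hD hmU hm₁ hm₂ hUb h₁b h₂b hUD' ht a₁ a₂ b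
  -- remove the indicator inside `1_D·(Ũ − b)^k`
  have e2 : (fun a => sfInd H s a * ((smallField H s).indicator (tiltU β H) a - b) ^ 2) = fun a => sfInd H s a * (tiltU β H a - b) ^ 2 := by
    funext a; exact sfInd_mul_indicator_eq β s (fun u => (u - b) ^ 2) a
  have e4 : (fun a => sfInd H s a * ((smallField H s).indicator (tiltU β H) a - b) ^ 4) = fun a => sfInd H s a * (tiltU β H a - b) ^ 4 := by
    funext a; exact sfInd_mul_indicator_eq β s (fun u => (u - b) ^ 4) a
  have e6 : (fun a => sfInd H s a * ((smallField H s).indicator (tiltU β H) a - b) ^ 6) = fun a => sfInd H s a * (tiltU β H a - b) ^ 6 := by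
    funext a; exact sfInd_mul_indicator_eq β s (fun u => (u - b) ^ 6) a
  rw [e2, e4, e6] at h
  exact h

end GaussNormalForm

end Summit.QuantumFields.YangMills.Theorems.AllWindowsColdBoxBoxHighLine

end
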